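import Summits.Ventures.Crystal3D.StickySpheres.FiveRing
import HarnessLib

/-!
# The unit octahedron is rigid, and two of its caps never touch

Venture `Crystal3D` (cell `pub-crystal3d`, seat p2). Elementary Euclidean geometry in `ℝ³`, by linear algebra without
angles or coordinates (unit DIAMETER convention: touching centres are at distance `1`).

* `octahedron_frame`, `octahedron_cap` — let `a, a', b, b', c, c'` realise the octahedron graph `K_{2,2,2}` with unit
  edges (all pairs at distance `1` except the three "antipodal" pairs `aa', bb', cc'`, only required to be at distance
  `≥ 1`). Then the configuration is the regular octahedron (`a + a' = b + b' = c + c'`, diagonals of length `√2`,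
  pairwise orthogonal), and a seventh point `x` at distance `1` from `a, b, c` and at distance `≥ 1` from `a'` is the
  outer apex of the regular tetrahedron on the face `abc`: `x = b + c − a'`.
* `no_bicapped_octahedron_opp/vtx/edge` — two such caps on two distinct faces are at squared distance `6` (opposite
  faces), `4` (faces sharing a vertex) or `2` (faces sharing an edge), never `1`. These are the three bi-capped-octahedron
  contact patterns on eight balls with nineteen contacts that survive the combinatorial filters of the cell's enumeration
  at `n = 8`; with `TetraCaps.lean` they make `C(8) = 18` unconditional (`StickySpheres/ContactEight.lean`).

HONEST FRAMING: folklore solid geometry, formalised; nothing enumerative and nothing about crystallization is claimed.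
-/

noncomputable section

open Real RealInnerProductSpace

namespace Summit.Ventures.Crystal3D

/-! ### Linear-algebra tools in `ℝ³` -/

/-- A vector orthogonal to three pairwise orthogonal non-zero vectors of `ℝ³` vanishes. [folklore] -/
theorem eq_zero_of_inner_three {e f d v : EuclideanSpace ℝ (Fin 3)} (he : e ≠ 0) (hf : f ≠ 0) (hd : d ≠ 0)
    (hef : ⟪e, f⟫ = 0) (hed : ⟪e, d⟫ = 0) (hfd : ⟪f, d⟫ = 0) (hve : ⟪e, v⟫ = 0) (hvf : ⟪f, v⟫ = 0)
    (hvd : ⟪d, v⟫ = 0) : v = 0 := by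
  by_contra hv
  obtain ⟨α, β, γ, hne, hrel⟩ := exists_rel_of_orthogonal hv hve hvf hvd
  have h1 := inner_rel_eq_zero (v := e) hrel
  have h2 := inner_rel_eq_zero (v := f) hrel
  have h3 := inner_rel_eq_zero (v := d) hrel
  have hfe : ⟪f, e⟫ = 0 := by rw [real_inner_comm]; exact hef
  have hde : ⟪d, e⟫ = 0 := by rw [real_inner_comm]; exact hed
  have hdf : ⟪d, f⟫ = 0 := by rw [real_inner_comm]; exact hfd
  rw [hfe, hde] at h1
  rw [hef, hdf] at h2
  rw [hed, hfd] at h3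
  have hee : ⟪e, e⟫ ≠ 0 := fun h => he (inner_self_eq_zero.1 h)
  have hff : ⟪f, f⟫ ≠ 0 := fun h => hf (inner_self_eq_zero.1 h)
  have hdd : ⟪d, d⟫ ≠ 0 := fun h => hd (inner_self_eq_zero.1 h)
  have hα : α = 0 := by
    have : α * ⟪e, e⟫ = 0 := by linarith
    exact (mul_eq_zero.1 this).resolve_right hee
  have hβ : β = 0 := by
    have : β * ⟪f, f⟫ = 0 := by linarith
    exact (mul_eq_zero.1 this).resolve_right hff
  have hγ : γ = 0 := by
    have : γ * ⟪d, d⟫ = 0 := by linarith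
    exact (mul_eq_zero.1 this).resolve_right hdd
  rcases hne with h | h | h
  · exact h hα
  · exact h hβ
  · exact h hγ

/-- Inner product of two difference vectors from a common base point, from the three distances. [folklore] -/
theorem inner_sub_sub_of_dist (o p q : EuclideanSpace ℝ (Fin 3)) :
    ⟪p - o, q - o⟫ = (dist p o ^ 2 + dist q o ^ 2 - dist p q ^ 2) / 2 := by
  have e1 := norm_sub_sq_real (p - o) (q - o)
  have e2 : p - o - (q - o) = p - q := by abel
  rw [e2, ← dist_eq_norm, ← dist_eq_norm, ← dist_eq_norm] at e1
  linarith

/-! ### The octahedron -/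

section Octahedron

variable {a a' b b' c c' x y : EuclideanSpace ℝ (Fin 3)}

/-- **Rigidity of the unit octahedron, seen from the vertex `a`.** With `A = a' − a`, `B = b − a`, …: the twelve unit
edges and the three antipodal distances `≥ 1` force `B' = A − B`, `C' = A − C`, `‖A‖² = 2` (so `⟪A, B⟫ = ⟪A, C⟫ = 1`).
[folklore] -/
theorem octahedron_frame (hab : dist a b = 1) (hab' : dist a b' = 1) (hac : dist a c = 1) (hac' : dist a c' = 1)
    (ha'b : dist a' b = 1) (ha'b' : dist a' b' = 1) (ha'c : dist a' c = 1) (ha'c' : dist a' c' = 1)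
    (hbc : dist b c = 1) (hbc' : dist b c' = 1) (hb'c : dist b' c = 1) (hb'c' : dist b' c' = 1)
    (haa' : 1 ≤ dist a a') (hbb' : 1 ≤ dist b b') (hcc' : 1 ≤ dist c c') :
    b' - a = (a' - a) - (b - a) ∧ c' - a = (a' - a) - (c - a) ∧ ⟪a' - a, a' - a⟫ = 2 := by
  -- Gram data seen from `a`
  have gAB := inner_sub_sub_of_dist a a' b
  have gAB' := inner_sub_sub_of_dist a a' b'
  have gAC := inner_sub_sub_of_dist a a' c
  have gAC' := inner_sub_sub_of_dist a a' c'
  have gBC := inner_sub_sub_of_dist a b c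
  have gBC' := inner_sub_sub_of_dist a b c'
  have gB'C := inner_sub_sub_of_dist a b' c
  have gB'C' := inner_sub_sub_of_dist a b' c'
  have gBB := inner_sub_sub_of_dist a b b
  have gB'B' := inner_sub_sub_of_dist a b' b'
  have gCC := inner_sub_sub_of_dist a c c
  have gC'C' := inner_sub_sub_of_dist a c' c'
  have gBB' := inner_sub_sub_of_dist a b b'
  have gCC' := inner_sub_sub_of_dist a c c'
  have gAA := inner_sub_sub_of_dist a a' a'
  rw [dist_comm b a, dist_comm b' a, dist_comm c a, dist_comm c' a] at *
  rw [hab, hab', hac, hac', ha'b, ha'b', ha'c, ha'c', hbc, hbc', hb'c, hb'c', dist_self] at *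
  set A := a' - a with hA
  set B := b - a with hB
  set B' := b' - a with hB'
  set C := c - a with hC
  set C' := c' - a with hC'
  have gBA : ⟪B, A⟫ = ⟪A, B⟫ := real_inner_comm _ _
  have gB'A : ⟪B', A⟫ = ⟪A, B'⟫ := real_inner_comm _ _
  have gCA : ⟪C, A⟫ = ⟪A, C⟫ := real_inner_comm _ _
  have gC'A : ⟪C', A⟫ = ⟪A, C'⟫ := real_inner_comm _ _
  have gCB : ⟪C, B⟫ = ⟪B, C⟫ := real_inner_comm _ _
  have gC'B : ⟪C', B⟫ = ⟪B, C'⟫ := real_inner_comm _ _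
  have gCB' : ⟪C, B'⟫ = ⟪B', C⟫ := real_inner_comm _ _
  have gC'B' : ⟪C', B'⟫ = ⟪B', C'⟫ := real_inner_comm _ _
  have gB'B : ⟪B', B⟫ = ⟪B, B'⟫ := real_inner_comm _ _
  have gC'C : ⟪C', C⟫ = ⟪C, C'⟫ := real_inner_comm _ _
  -- the three axis vectors `A`, `B − B'`, `C − C'` are non-zero and pairwise orthogonal
  have hA0 : A ≠ 0 := by
    rw [hA, sub_ne_zero]; intro h; rw [h, dist_self] at haa'; linarith
  have hF0 : B - B' ≠ 0 := by
    rw [hB, hB', show b - a - (b' - a) = b - b' by abel, sub_ne_zero]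
    intro h; rw [h, dist_self] at hbb'; linarith
  have hD0 : C - C' ≠ 0 := by
    rw [hC, hC', show c - a - (c' - a) = c - c' by abel, sub_ne_zero]
    intro h; rw [h, dist_self] at hcc'; linarith
  have oAF : ⟪A, B - B'⟫ = 0 := by
    simp only [inner_sub_right]; linarith
  have oAD : ⟪A, C - C'⟫ = 0 := by
    simp only [inner_sub_right]; linarith
  have oFD : ⟪B - B', C - C'⟫ = 0 := by
    simp only [inner_sub_left, inner_sub_right]; linarith
  -- `B + B' − A` and `C + C' − A` are orthogonal to all three axes, hence zero
  have hv : B + B' - A = 0 := by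
    refine eq_zero_of_inner_three hA0 hF0 hD0 oAF oAD oFD ?_ ?_ ?_
    · simp only [inner_sub_right, inner_add_right]; linarith
    · simp only [inner_sub_left, inner_sub_right, inner_add_right]; linarith
    · simp only [inner_sub_left, inner_sub_right, inner_add_right]; linarith
  have hw : C + C' - A = 0 := by
    refine eq_zero_of_inner_three hA0 hF0 hD0 oAF oAD oFD ?_ ?_ ?_
    · simp only [inner_sub_right, inner_add_right]; linarith
    · simp only [inner_sub_left, inner_sub_right, inner_add_right]; linarith
    · simp only [inner_sub_left, inner_sub_right, inner_add_right]; linarith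
  have hv' : B' = A - B := by rw [sub_eq_zero] at hv; rw [← hv]; abel
  have hw' : C' = A - C := by rw [sub_eq_zero] at hw; rw [← hw]; abel
  refine ⟨hv', hw', ?_⟩
  -- the diagonal: `⟪B + B', C⟫ = ⟪A, C⟫` gives `‖A‖² = 2`
  have e : ⟪B', C⟫ = ⟪A, C⟫ - ⟪B, C⟫ := by rw [hv', inner_sub_left]
  linarith

/-- **The cap of a unit octahedron.** In the situation of `octahedron_frame`, a point `x` at distance `1` from the three
vertices `a, b, c` of a face and at distance `≥ 1` from `a'` is `x = b + c − a'` (the outer apex of the regular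
tetrahedron on that face; the inner solution would be at distance `1/√3 < 1` from `a'`). [folklore] -/
theorem octahedron_cap (hab : dist a b = 1) (hab' : dist a b' = 1) (hac : dist a c = 1)
    (hac' : dist a c' = 1) (ha'b : dist a' b = 1) (ha'b' : dist a' b' = 1) (ha'c : dist a' c = 1) (ha'c' : dist a' c' = 1)
    (hbc : dist b c = 1) (hbc' : dist b c' = 1) (hb'c : dist b' c = 1) (hb'c' : dist b' c' = 1)
    (haa' : 1 ≤ dist a a') (hbb' : 1 ≤ dist b b') (hcc' : 1 ≤ dist c c')
    (hxa : dist x a = 1) (hxb : dist x b = 1) (hxc : dist x c = 1) (hxa' : 1 ≤ dist x a') : x = b + c - a' := by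
  obtain ⟨hB', hC', gAA⟩ :=
    octahedron_frame hab hab' hac hac' ha'b ha'b' ha'c ha'c' hbc hbc' hb'c hb'c' haa' hbb' hcc'
  -- Gram data of `A, B, C, X` seen from `a`
  have gAB := inner_sub_sub_of_dist a a' b
  have gAC := inner_sub_sub_of_dist a a' c
  have gBC := inner_sub_sub_of_dist a b c
  have gBB := inner_sub_sub_of_dist a b b
  have gCC := inner_sub_sub_of_dist a c c
  have gXX := inner_sub_sub_of_dist a x x
  have gXB := inner_sub_sub_of_dist a x b
  have gXC := inner_sub_sub_of_dist a x c
  have gXA := inner_sub_sub_of_dist a x a'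
  have hx1 : 1 ≤ dist x a' ^ 2 := one_le_pow₀ hxa'
  rw [dist_comm b a, dist_comm c a] at *
  rw [hab, hac, ha'b, ha'c, hbc, hxa, hxb, hxc, dist_self] at *
  have hdA : dist a' a ^ 2 = 2 := by
    rw [dist_eq_norm, ← real_inner_self_eq_norm_sq, gAA]
  rw [hdA] at gAB gAC gXA
  set A := a' - a with hA
  set B := b - a with hB
  set C := c - a with hC
  set X := x - a with hX
  have gBA : ⟪B, A⟫ = ⟪A, B⟫ := real_inner_comm _ _
  have gCA : ⟪C, A⟫ = ⟪A, C⟫ := real_inner_comm _ _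
  have gCB : ⟪C, B⟫ = ⟪B, C⟫ := real_inner_comm _ _
  have gAX : ⟪A, X⟫ = ⟪X, A⟫ := real_inner_comm _ _
  have gBX : ⟪B, X⟫ = ⟪X, B⟫ := real_inner_comm _ _
  have gCX : ⟪C, X⟫ = ⟪X, C⟫ := real_inner_comm _ _
  -- the orthogonal axes `A`, `F = 2B − A`, `D = 2C − A` (each of squared length `2`)
  have hA0 : A ≠ 0 := by
    rw [hA, sub_ne_zero]; intro h; rw [h, dist_self] at haa'; linarith
  have hF0 : B + B - A ≠ 0 := by
    intro h
    have e : ⟪B + B - A, B + B - A⟫ = 0 := by rw [h, inner_zero_left]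
    simp only [inner_sub_left, inner_sub_right, inner_add_left, inner_add_right] at e
    linarith
  have hD0 : C + C - A ≠ 0 := by
    intro h
    have e : ⟪C + C - A, C + C - A⟫ = 0 := by rw [h, inner_zero_left]
    simp only [inner_sub_left, inner_sub_right, inner_add_left, inner_add_right] at e
    linarith
  have oAF : ⟪A, B + B - A⟫ = 0 := by
    simp only [inner_sub_right, inner_add_right]; linarith
  have oAD : ⟪A, C + C - A⟫ = 0 := by
    simp only [inner_sub_right, inner_add_right]; linarith
  have oFD : ⟪B + B - A, C + C - A⟫ = 0 := by
    simp only [inner_sub_left, inner_sub_right, inner_add_left, inner_add_right]; linarith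
  -- coordinates of `X` along the axes
  set σ : ℝ := ⟪X, A⟫ with hσ
  have hXexp : X = (σ / 2) • A + ((1 - σ) / 2) • (B + B - A) + ((1 - σ) / 2) • (C + C - A) := by
    have hz := eq_zero_of_inner_three hA0 hF0 hD0 oAF oAD oFD
      (v := X - ((σ / 2) • A + ((1 - σ) / 2) • (B + B - A) + ((1 - σ) / 2) • (C + C - A))) ?_ ?_ ?_
    · exact sub_eq_zero.1 hz
    · simp only [inner_sub_right, inner_add_right, real_inner_smul_right, gAA, gAB, gAC, gAX]
      ring
    · simp only [inner_sub_left, inner_sub_right, inner_add_left, inner_add_right, real_inner_smul_right, gBX, gXB,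
        gAX, gBA, gAB, gAA, gBB, gBC, gAC]
      ring
    · simp only [inner_sub_left, inner_sub_right, inner_add_left, inner_add_right, real_inner_smul_right, gCX, gXC,
        gAX, gCA, gAC, gAA, gCB, gBC, gCC, gAB]
      ring
  -- `‖X‖² = 1` in coordinates: `σ²/2 + (1 − σ)² = 1`, i.e. `σ (3σ − 4) = 0`; and `σ ≤ 1`
  have key : σ * (3 * σ - 4) = 0 := by
    have e : ⟪X, X⟫ = ⟪(σ / 2) • A + ((1 - σ) / 2) • (B + B - A) + ((1 - σ) / 2) • (C + C - A),
        (σ / 2) • A + ((1 - σ) / 2) • (B + B - A) + ((1 - σ) / 2) • (C + C - A)⟫ := by rw [← hXexp]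
    simp only [inner_sub_left, inner_sub_right, inner_add_left, inner_add_right, real_inner_smul_left,
      real_inner_smul_right, gXX, gAA, gAB, gAC, gBA, gBB, gBC, gCA, gCB, gCC] at e
    linear_combination (-2 : ℝ) * e
  have hσ1 : σ ≤ 1 := by linarith
  have hσ0 : σ = 0 := by
    rcases mul_eq_zero.1 key with h | h
    · exact h
    · exfalso; linarith
  rw [hσ0] at hXexp
  norm_num at hXexp
  -- `hXexp : X = (1/2) • (B + B - A) + (1/2) • (C + C - A)`
  have e : X = B + C - A := by
    rw [hXexp, ← smul_add, show B + B - A + (C + C - A) = (B + C - A) + (B + C - A) by abel, ← two_smul ℝ,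
      smul_smul]
    norm_num
  have e' : x = a + (B + C - A) := by rw [← e, hX]; abel
  rw [e', hA, hB, hC]; abel

/-! ### Two caps of an octahedron never touch -/

/-- **Caps on opposite faces** `abc` and `a'b'c'` are at squared distance `6`; in particular they do not touch.
[folklore] -/
theorem no_bicapped_octahedron_opp (hab : dist a b = 1) (hab' : dist a b' = 1) (hac : dist a c = 1)
    (hac' : dist a c' = 1) (ha'b : dist a' b = 1) (ha'b' : dist a' b' = 1) (ha'c : dist a' c = 1) (ha'c' : dist a' c' = 1)
    (hbc : dist b c = 1) (hbc' : dist b c' = 1) (hb'c : dist b' c = 1) (hb'c' : dist b' c' = 1)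
    (haa' : 1 ≤ dist a a') (hbb' : 1 ≤ dist b b') (hcc' : 1 ≤ dist c c')
    (hxa : dist x a = 1) (hxb : dist x b = 1) (hxc : dist x c = 1) (hxa' : 1 ≤ dist x a')
    (hya' : dist y a' = 1) (hyb' : dist y b' = 1) (hyc' : dist y c' = 1) (hya : 1 ≤ dist y a)
    (hxy : dist x y = 1) : False := by
  obtain ⟨hB', hC', gAA⟩ :=
    octahedron_frame hab hab' hac hac' ha'b ha'b' ha'c ha'c' hbc hbc' hb'c hb'c' haa' hbb' hcc'
  have hx := octahedron_cap hab hab' hac hac' ha'b ha'b' ha'c ha'c' hbc hbc' hb'c hb'c' haa' hbb' hcc' hxa hxb hxc hxa'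
  -- the same octahedron with every antipodal pair swapped: face `a'b'c'`, far vertex `a`
  have hy := octahedron_cap (a := a') (a' := a) (b := b') (b' := b) (c := c') (c' := c) ha'b' ha'b ha'c' ha'c hab' hab
    hac' hac hb'c' hb'c hbc' hbc (by rw [dist_comm]; exact haa') (by rw [dist_comm]; exact hbb')
    (by rw [dist_comm]; exact hcc') hya' hyb' hyc' hya
  have gAB := inner_sub_sub_of_dist a a' b
  have gAC := inner_sub_sub_of_dist a a' c
  have gBC := inner_sub_sub_of_dist a b c
  have gBB := inner_sub_sub_of_dist a b b
  have gCC := inner_sub_sub_of_dist a c c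
  rw [dist_comm b a, dist_comm c a] at *
  rw [hab, hac, ha'b, ha'c, hbc, dist_self] at *
  have hdA : dist a' a ^ 2 = 2 := by
    rw [dist_eq_norm, ← real_inner_self_eq_norm_sq, gAA]
  rw [hdA] at gAB gAC
  have e : x - y = (b - a) + (b - a) + (c - a) + (c - a) - (a' - a) - (a' - a) - (a' - a) := by
    rw [hx, hy, show b' = (b' - a) + a by abel, show c' = (c' - a) + a by abel, hB', hC']; abel
  set A := a' - a with hA
  set B := b - a with hB
  set C := c - a with hC
  have gBA : ⟪B, A⟫ = ⟪A, B⟫ := real_inner_comm _ _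
  have gCA : ⟪C, A⟫ = ⟪A, C⟫ := real_inner_comm _ _
  have gCB : ⟪C, B⟫ = ⟪B, C⟫ := real_inner_comm _ _
  have hd : dist x y ^ 2 = 6 := by
    rw [dist_eq_norm, ← real_inner_self_eq_norm_sq, e]
    simp only [inner_sub_left, inner_sub_right, inner_add_left, inner_add_right]
    linarith
  rw [hxy] at hd
  norm_num at hd

/-- **Caps on two faces sharing a vertex** (`abc` and `a'b'c`) are at squared distance `4`; they do not touch.
[folklore] -/
theorem no_bicapped_octahedron_vtx (hab : dist a b = 1) (hab' : dist a b' = 1) (hac : dist a c = 1)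
    (hac' : dist a c' = 1) (ha'b : dist a' b = 1) (ha'b' : dist a' b' = 1) (ha'c : dist a' c = 1) (ha'c' : dist a' c' = 1)
    (hbc : dist b c = 1) (hbc' : dist b c' = 1) (hb'c : dist b' c = 1) (hb'c' : dist b' c' = 1)
    (haa' : 1 ≤ dist a a') (hbb' : 1 ≤ dist b b') (hcc' : 1 ≤ dist c c')
    (hxa : dist x a = 1) (hxb : dist x b = 1) (hxc : dist x c = 1) (hxa' : 1 ≤ dist x a')
    (hya' : dist y a' = 1) (hyb' : dist y b' = 1) (hyc : dist y c = 1) (hya : 1 ≤ dist y a)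
    (hxy : dist x y = 1) : False := by
  obtain ⟨hB', hC', gAA⟩ :=
    octahedron_frame hab hab' hac hac' ha'b ha'b' ha'c ha'c' hbc hbc' hb'c hb'c' haa' hbb' hcc'
  have hx := octahedron_cap hab hab' hac hac' ha'b ha'b' ha'c ha'c' hbc hbc' hb'c hb'c' haa' hbb' hcc' hxa hxb hxc hxa'
  -- the same octahedron with `a ↔ a'`, `b ↔ b'` swapped: face `a'b'c`, far vertex `a`
  have hy := octahedron_cap (a := a') (a' := a) (b := b') (b' := b) (c := c) (c' := c') ha'b' ha'b ha'c ha'c' hab' hab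
    hac hac' hb'c hb'c' hbc hbc' (by rw [dist_comm]; exact haa') (by rw [dist_comm]; exact hbb') hcc' hya' hyb' hyc hya
  have gAB := inner_sub_sub_of_dist a a' b
  have gBB := inner_sub_sub_of_dist a b b
  rw [dist_comm b a] at *
  rw [hab, ha'b, dist_self] at *
  have hdA : dist a' a ^ 2 = 2 := by
    rw [dist_eq_norm, ← real_inner_self_eq_norm_sq, gAA]
  rw [hdA] at gAB
  have e : x - y = (b - a) + (b - a) - (a' - a) - (a' - a) := by
    rw [hx, hy, show b' = (b' - a) + a by abel, hB']; abel
  set A := a' - a with hA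
  set B := b - a with hB
  have gBA : ⟪B, A⟫ = ⟪A, B⟫ := real_inner_comm _ _
  have hd : dist x y ^ 2 = 4 := by
    rw [dist_eq_norm, ← real_inner_self_eq_norm_sq, e]
    simp only [inner_sub_left, inner_sub_right, inner_add_left, inner_add_right]
    linarith
  rw [hxy] at hd
  norm_num at hd

/-- **Caps on two faces sharing an edge** (`abc` and `a'bc`) are at squared distance `2`; they do not touch.
[folklore] -/
theorem no_bicapped_octahedron_edge (hab : dist a b = 1) (hab' : dist a b' = 1) (hac : dist a c = 1)
    (hac' : dist a c' = 1) (ha'b : dist a' b = 1) (ha'b' : dist a' b' = 1) (ha'c : dist a' c = 1) (ha'c' : dist a' c' = 1)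
    (hbc : dist b c = 1) (hbc' : dist b c' = 1) (hb'c : dist b' c = 1) (hb'c' : dist b' c' = 1)
    (haa' : 1 ≤ dist a a') (hbb' : 1 ≤ dist b b') (hcc' : 1 ≤ dist c c')
    (hxa : dist x a = 1) (hxb : dist x b = 1) (hxc : dist x c = 1) (hxa' : 1 ≤ dist x a')
    (hya' : dist y a' = 1) (hyb : dist y b = 1) (hyc : dist y c = 1) (hya : 1 ≤ dist y a)
    (hxy : dist x y = 1) : False := by
  obtain ⟨-, -, gAA⟩ :=
    octahedron_frame hab hab' hac hac' ha'b ha'b' ha'c ha'c' hbc hbc' hb'c hb'c' haa' hbb' hcc'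
  have hx := octahedron_cap hab hab' hac hac' ha'b ha'b' ha'c ha'c' hbc hbc' hb'c hb'c' haa' hbb' hcc' hxa hxb hxc hxa'
  -- the same octahedron with `a ↔ a'` swapped: face `a'bc`, far vertex `a`
  have hy := octahedron_cap (a := a') (a' := a) (b := b) (b' := b') (c := c) (c' := c') ha'b ha'b' ha'c ha'c' hab hab'
    hac hac' hbc hbc' hb'c hb'c' (by rw [dist_comm]; exact haa') hbb' hcc' hya' hyb hyc hya
  have e : x - y = -(a' - a) := by rw [hx, hy]; abel
  have hd : dist x y ^ 2 = 2 := by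
    rw [dist_eq_norm, ← real_inner_self_eq_norm_sq, e, inner_neg_left, inner_neg_right, neg_neg, gAA]
  rw [hxy] at hd
  norm_num at hd

end Octahedron

end Summit.Ventures.Crystal3D

end
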